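import Mathlib.Data.List.Sort
import Mathlib.LinearAlgebra.Dimension.Constructions
import Mathlib.LinearAlgebra.FiniteDimensional.Lemmas
import Literature.Barriers.MatrixMultiplication.NilpotentGroupBarrierPWords
import Literature.Barriers.MatrixMultiplication.NilpotentGroupBarrierGradedCoords
import HarnessLib

/-!
# Words in a `p`-central generating system, II: straightening, the monomial basis and its grading (Jennings' theorem in the form of BCCGU 2017, Prop. 3.10)

Topic `Literature/Barriers/MatrixMultiplication`; sequel of `NilpotentGroupBarrierPWords.lean`
(towards the discharge of `BCCGU2017_cor320`, Blasiak–Church–Cohn–Grochow–Umans 2017,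
Cor. 3.20). For a `p`-central generating system `C : PCGS p S ι` and a field `K` of
characteristic `p` we prove the STRAIGHTENING theorem behind the Jennings basis (BCCGU Prop. 3.10,
citing Jennings 1941: "a basis for `I^k` is given by those `∏ x_{j,i}^{m_{j,i}}` with degree
`≥ k` … the degree of a product of such basis elements is the sum of the degrees") in the form
needed for the slice-rank bound:

* `PCGS.eval_mem_M` — every word `w` in the letters `u_a = gen(a) - 1` lies in the span `M (wt w)`
  of the CANONICAL words (sorted, each letter `< p` times) of weight `≥ wt w`
  (weights `W a = (p+1)^{lvl a}`). Proof: descending induction on the weight (long words vanish,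
  `eval_eq_zero_of_wt_ge`) and, at fixed weight, induction on the number of inversions
  (`inversions`, `inversions_swap`): an adjacent inversion is swapped by the commutation rule
  `u_mul_u`, a sorted word with a letter repeated `p` times is rewritten by the power rule
  `u_pow_p`; all correction terms have strictly larger weight since commutators and `p`-th powers
  of generators are products of generators of strictly higher level.
* `PCGS.M_mul_M_le` — hence `M_a · M_b ⊆ M_{a+b}`.
* `PCGS.basis` — the monomials `u^e = ∏ₐ u_a^{e a}`, `e ∈ [0,p)^ι`, form a basis of `K[S]`
  (they span by straightening + `span_eval_eq_top`, and `#[0,p)^ι = p^{|ι|} = |S| = dim K[S]`).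
* `PCGS.gradedCoords` — the resulting `GradedCoords K S (ι → Fin p)`
  (`NilpotentGroupBarrierGradedCoords.lean`) with `deg e = Σₐ e_a (p+1)^{lvl a}`
  (`gradedCoords_deg`), i.e. the input of the codimension bound `GradedCoords.sliceRank_le`.

Source: J. Blasiak, T. Church, H. Cohn, J. A. Grochow, C. Umans, *Which groups are amenable to
proving exponent two for matrix multiplication?*, arXiv:1712.02302
[BlasiakChurchCohnGrochowUmans2017], Prop. 3.10 and proof (held text pp. 6–7); S. A. Jennings,
*The structure of the group ring of a `p`-group over a modular field*, Trans. AMS 50 (1941)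
(cited through BCCGU).
-/

noncomputable section

open scoped BigOperators commutatorElement
open Finset

namespace Literature.Barriers.MatrixMultiplication

universe u v w

/-! ## Inversions of a word -/

section Inversions

variable {α : Type*} [LinearOrder α]

/-- Number of inversions (pairs `i < j` with `w_j < w_i`) of a word. [folklore] -/
def inversions : List α → ℕ
  | [] => 0
  | a :: w => w.countP (fun b => b < a) + inversions w

/-- Cross inversions between a prefix and a suffix. [folklore] -/
def crossInv (l₁ l₂ : List α) : ℕ := (l₁.map fun a => l₂.countP fun b => b < a).sum

/-- Inversions of a concatenation. [folklore] -/
theorem inversions_append (l₁ l₂ : List α) :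
    inversions (l₁ ++ l₂) = inversions l₁ + inversions l₂ + crossInv l₁ l₂ := by
  induction l₁ with
  | nil => simp [inversions, crossInv]
  | cons a l₁ ih =>
    simp only [List.cons_append, inversions, ih, List.countP_append, crossInv, List.map_cons,
      List.sum_cons]
    simp only [crossInv] at ih ⊢
    omega

/-- Cross inversions only depend on the multiset of the suffix. [folklore] -/
theorem crossInv_perm (l₁ : List α) {l₂ l₂' : List α} (h : l₂.Perm l₂') :
    crossInv l₁ l₂ = crossInv l₁ l₂' := by
  unfold crossInv
  congr 1
  exact List.map_congr_left fun a _ => h.countP_eq _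

/-- Swapping an adjacent inversion removes exactly one inversion. [folklore] -/
theorem inversions_swap (pre suf : List α) {x y : α} (h : y < x) :
    inversions (pre ++ x :: y :: suf) = inversions (pre ++ y :: x :: suf) + 1 := by
  rw [inversions_append, inversions_append, crossInv_perm pre (List.Perm.swap y x suf)]
  have h1 : inversions (x :: y :: suf) = inversions (y :: x :: suf) + 1 := by
    simp only [inversions, List.countP_cons, h, decide_true, not_lt.2 h.le, decide_false]
    simp
    omega
  omega

/-- An unsorted word has an adjacent inversion. [folklore] -/
theorem exists_adjacent_inversion :
    ∀ {w : List α}, ¬ w.Pairwise (· ≤ ·) →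
      ∃ pre suf x y, w = pre ++ x :: y :: suf ∧ y < x := by
  intro w
  induction w with
  | nil => intro h; simp at h
  | cons a w ih =>
    intro h
    by_cases hw : w.Pairwise (· ≤ ·)
    · -- the failure is at the head
      rw [List.pairwise_cons] at h
      have h' : ¬ ∀ b ∈ w, a ≤ b := fun hh => h ⟨hh, hw⟩
      push Not at h'
      obtain ⟨b, hb, hba⟩ := h'
      cases w with
      | nil => simp at hb
      | cons c w =>
        refine ⟨[], w, a, c, rfl, ?_⟩
        rcases List.mem_cons.1 hb with rfl | hb'
        · exact hba
        · exact lt_of_le_of_lt ((List.pairwise_cons.1 hw).1 b hb') hba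
    · obtain ⟨pre, suf, x, y, rfl, hxy⟩ := ih hw
      exact ⟨a :: pre, suf, x, y, rfl, hxy⟩

end Inversions

/-! ## Canonical words over a finite ordered alphabet -/

section CanonWord

variable {ι : Type w} [LinearOrder ι] [Fintype ι]

/-- Sums along the sorted enumeration of the alphabet. [folklore] -/
theorem sum_map_sort_univ {M : Type*} [AddCommMonoid M] (g : ι → M) :
    ((Finset.univ.sort (· ≤ ·)).map g).sum = ∑ a, g a := by
  classical
  rw [← List.sum_toFinset g (Finset.sort_nodup _ _), Finset.sort_toFinset]

/-- A word is canonical if it is sorted and every letter occurs `< p` times. [folklore] -/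
def IsCanonWord (p : ℕ) (w : List ι) : Prop := w.Pairwise (· ≤ ·) ∧ ∀ a, w.count a < p

/-- Letter counts of a canonical word. [folklore] -/
theorem count_canonWord (e : ι → ℕ) (a : ι) : (canonWord e).count a = e a := by
  rw [canonWord, List.count_flatMap]
  have : (fun b => List.count a (List.replicate (e b) b)) = fun b => if b = a then e a else 0 := by
    funext b
    rw [List.count_replicate]
    by_cases h : b = a
    · subst h; simp
    · simp [h]
  rw [Function.comp_def, this, sum_map_sort_univ]
  simp

/-- Canonical words are sorted. [folklore] -/
theorem canonWord_pairwise (e : ι → ℕ) : (canonWord e).Pairwise (· ≤ ·) := by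
  rw [canonWord, List.pairwise_flatMap]
  constructor
  · intro a _
    rw [List.pairwise_replicate]
    exact Or.inr le_rfl
  · refine (Finset.sortedLT_sort (Finset.univ : Finset ι)).pairwise.imp ?_
    intro a b hab x hx y hy
    rw [List.eq_of_mem_replicate hx, List.eq_of_mem_replicate hy]
    exact hab.le

/-- `canonWord e` is canonical when all `e a < p`. [folklore] -/
theorem isCanonWord_canonWord {p : ℕ} {e : ι → ℕ} (he : ∀ a, e a < p) :
    IsCanonWord p (canonWord e) :=
  ⟨canonWord_pairwise e, fun a => by rw [count_canonWord]; exact he a⟩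

/-- A sorted word is the canonical word of its letter counts. [folklore] -/
theorem eq_canonWord_count {w : List ι} (hw : w.Pairwise (· ≤ ·)) :
    w = canonWord (fun a => w.count a) := by
  refine List.Perm.eq_of_sortedLE hw.sortedLE (canonWord_pairwise _).sortedLE ?_
  rw [List.perm_iff_count]
  intro a
  rw [count_canonWord]

/-- Splitting a canonical word at a letter: `canonWord e = pre ++ a^{e a} ++ suf`. [folklore] -/
theorem canonWord_split (e : ι → ℕ) (a : ι) :
    ∃ pre suf, canonWord e = pre ++ List.replicate (e a) a ++ suf := by
  obtain ⟨s, t, hst⟩ := List.append_of_mem ((Finset.mem_sort (· ≤ ·)).2 (Finset.mem_univ a))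
  refine ⟨s.flatMap fun b => List.replicate (e b) b, t.flatMap fun b => List.replicate (e b) b, ?_⟩
  rw [canonWord, hst, List.flatMap_append, List.flatMap_cons, List.append_assoc]

end CanonWord

namespace PCGS

variable {p : ℕ} {S : Type u} [Group S] {ι : Type w} [LinearOrder ι] [Fintype ι]
  (C : PCGS p S ι)
variable {K : Type v} [Field K]

/-! ## Weights of canonical words -/

/-- `wt` over a `flatMap`. [folklore] -/
theorem wt_flatMap {β : Type*} (l : List β) (f : β → List ι) :
    C.wt (l.flatMap f) = (l.map fun b => C.wt (f b)).sum := by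
  induction l with
  | nil => simp
  | cons b l ih => rw [List.flatMap_cons, wt_append, ih, List.map_cons, List.sum_cons]

/-- The weight of a canonical word. [folklore] -/
theorem wt_canon (e : ι → ℕ) : C.wt (canonWord e) = ∑ a, e a * C.W a := by
  rw [canonWord, wt_flatMap]
  rw [show (fun a => C.wt (List.replicate (e a) a)) = fun a => e a * C.W a by
    funext a; simp [wt, List.map_replicate, List.sum_replicate]]
  exact sum_map_sort_univ _

/-! ## The filtration by canonical words and the straightening theorem -/

variable (K) in
/-- `M k` = span of the canonical words of weight `≥ k` (the candidate for the `k`-th power of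
the augmentation ideal / the weight filtration). [cite: BlasiakChurchCohnGrochowUmans2017, Prop. 3.10] -/
def M (k : ℕ) : Submodule K (MonoidAlgebra K S) :=
  Submodule.span K (C.eval K '' {w | IsCanonWord p w ∧ k ≤ C.wt w})

/-- `M` is antitone. [folklore] -/
theorem M_anti {k k' : ℕ} (h : k ≤ k') : C.M K k' ≤ C.M K k :=
  Submodule.span_mono (Set.image_mono fun _ hw => ⟨hw.1, h.trans hw.2⟩)

/-- Canonical words lie in `M` of their weight. [folklore] -/
theorem eval_mem_M_of_isCanon {w : List ι} (hw : IsCanonWord p w) : C.eval K w ∈ C.M K (C.wt w) :=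
  Submodule.subset_span ⟨w, ⟨hw, le_rfl⟩, rfl⟩

/-- Linear extension: if `z ∈ span (eval '' T)` then `A · z · B ∈ N` as soon as
`A · eval c · B ∈ N` for all `c ∈ T`. [folklore] -/
theorem mul_mem_of_mem_span {T : Set (List ι)} {z : MonoidAlgebra K S}
    (hz : z ∈ Submodule.span K (C.eval K '' T)) {N : Submodule K (MonoidAlgebra K S)}
    (A B : MonoidAlgebra K S) (h : ∀ c ∈ T, A * C.eval K c * B ∈ N) : A * z * B ∈ N := by
  induction hz using Submodule.span_induction with
  | mem y hy => obtain ⟨c, hc, rfl⟩ := hy; exact h c hc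
  | zero => simp
  | add y y' _ _ hy hy' => rw [mul_add, add_mul]; exact Submodule.add_mem _ hy hy'
  | smul r y _ hy => rw [mul_smul_comm, smul_mul_assoc]; exact Submodule.smul_mem _ r hy

/-- Weight of a non-empty sublist of a canonical word whose letters are all above level `t`.
[folklore] -/
theorem wt_ge_of_sublist_canon {e : ι → ℕ} {t : ℕ} (he : ∀ c, e c ≠ 0 → t < C.lvl c)
    {c : List ι} (hc : c.Sublist (canonWord e)) (hne : c ≠ []) :
    (p + 1) ^ (t + 1) ≤ C.wt c := by
  obtain ⟨a, ha⟩ := List.exists_mem_of_ne_nil c hne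
  have ha' : t + 1 ≤ C.lvl a := he a (mem_canonWord.1 (hc.subset ha))
  calc (p + 1) ^ (t + 1) ≤ C.W a := Nat.pow_le_pow_right (Nat.succ_pos p) ha'
    _ ≤ C.wt c := by
      unfold wt
      exact List.single_le_sum (fun _ _ => Nat.zero_le _) _ (List.mem_map_of_mem ha)

section Straighten

variable [Fact p.Prime] [CharP K p]

/-- **Straightening** (the heart of Jennings' theorem, BCCGU 2017 Prop. 3.10: "a basis for `I^k` is
given by those monomials with degree `≥ k`"): every word evaluates into the span of the canonical
words of at least its weight. Proof: descending induction on the weight (words of weight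
`≥ N*(p+1)^L` vanish), and for a fixed weight induction on the number of inversions: an adjacent
inversion is swapped by the commutation rule, a `p`-th power of a generator in a sorted word is
replaced by higher generators (power rule); all correction terms have strictly larger weight.
[cite: BlasiakChurchCohnGrochowUmans2017, Prop. 3.10] -/
theorem eval_mem_M (w : List ι) : C.eval K w ∈ C.M K (C.wt w) := by
  have hp1 : 1 < p := (Fact.out : p.Prime).one_lt
  -- descending induction on the weight
  suffices H : ∀ d : ℕ, ∀ w : List ι, C.Nstar * (p + 1) ^ C.L ≤ C.wt w + d →
      C.eval K w ∈ C.M K (C.wt w) from H _ w (Nat.le_add_left _ _)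
  intro d
  induction d with
  | zero =>
    intro w hw
    rw [C.eval_eq_zero_of_wt_ge (by simpa using hw)]
    exact Submodule.zero_mem _
  | succ d ihd =>
    intro w hw
    by_cases hlt : C.Nstar * (p + 1) ^ C.L ≤ C.wt w + d
    · exact ihd w hlt
    -- the outer induction hypothesis: words of larger weight are fine
    have hIH : ∀ w' : List ι, C.wt w < C.wt w' → C.eval K w' ∈ C.M K (C.wt w') :=
      fun w' hw' => ihd w' (by omega)
    -- the sorted case: canonical, or a `p`-th power of a generator to be rewritten
    have sorted_case : ∀ v : List ι, C.wt v = C.wt w → v.Pairwise (· ≤ ·) →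
        C.eval K v ∈ C.M K (C.wt v) := by
      intro v hv hs
      by_cases hcnt : ∀ a, v.count a < p
      · exact C.eval_mem_M_of_isCanon ⟨hs, hcnt⟩
      push Not at hcnt
      obtain ⟨a, ha⟩ := hcnt
      obtain ⟨pre, suf, hsplit⟩ := canonWord_split (fun b => v.count b) a
      have hrep : List.replicate (v.count a) a =
          List.replicate p a ++ List.replicate (v.count a - p) a := by
        rw [← List.replicate_add]; congr 1; omega
      set suf' := List.replicate (v.count a - p) a ++ suf with hsuf'
      have hv' : v = pre ++ List.replicate p a ++ suf' := by
        conv_lhs => rw [eq_canonWord_count hs, hsplit]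
        rw [hrep]
        simp only [hsuf', List.append_assoc]
      have hevalrep : C.eval K (List.replicate p a) = C.u K a ^ p := by
        simp [eval, List.map_replicate, List.prod_replicate]
      have hwtrep : C.wt (List.replicate p a) = p * C.W a := by
        simp [wt, List.map_replicate, List.sum_replicate]
      have heval : C.eval K v =
          C.eval K pre * (((canonWord (C.powExp a)).map fun b => C.u K b + 1).prod - 1) *
            C.eval K suf' := by
        rw [hv', eval_append, eval_append, hevalrep, C.u_pow_p, C.powExp_prod, C.of_orderedProd]
      rw [heval]
      refine C.mul_mem_of_mem_span (C.prod_add_one_mem_span (canonWord (C.powExp a))).2 _ _ ?_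
      intro c hc
      have hwc : p * C.W a < C.wt c := by
        have h := C.wt_ge_of_sublist_canon (C.powExp_lvl a) hc.1 hc.2
        have : p * C.W a < (p + 1) ^ (C.lvl a + 1) := by
          rw [pow_succ, W]
          have : 0 < (p + 1) ^ C.lvl a := Nat.pow_pos (Nat.succ_pos p)
          nlinarith
        omega
      rw [← eval_append, ← eval_append]
      have hlt' : C.wt v < C.wt (pre ++ c ++ suf') := by
        rw [hv']
        simp only [wt_append, hwtrep]
        omega
      exact C.M_anti hlt'.le (hIH _ (hv ▸ hlt'))
    -- inner induction on the number of inversions, at fixed weight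
    suffices H2 : ∀ m : ℕ, ∀ v : List ι, C.wt v = C.wt w → inversions v ≤ m →
        C.eval K v ∈ C.M K (C.wt v) from H2 _ w rfl le_rfl
    intro m
    induction m with
    | zero =>
      intro v hv hinv
      exact sorted_case v hv (by
        by_contra hs
        obtain ⟨pre, suf, x, y, rfl, hxy⟩ := exists_adjacent_inversion hs
        have := inversions_swap pre suf hxy
        omega)
    | succ m ihm =>
      intro v hv hinv
      by_cases hs : v.Pairwise (· ≤ ·)
      · exact sorted_case v hv hs
      obtain ⟨pre, suf, x, y, rfl, hxy⟩ := exists_adjacent_inversion hs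
      -- swap the inversion
      have hswap := inversions_swap pre suf hxy
      have hwt' : C.wt (pre ++ y :: x :: suf) = C.wt (pre ++ x :: y :: suf) := by
        simp only [wt_append, wt_cons]; ring
      have h1 : C.eval K (pre ++ y :: x :: suf) ∈ C.M K (C.wt (pre ++ x :: y :: suf)) := by
        rw [← hwt']
        exact ihm _ (hwt'.trans hv) (by omega)
      -- the correction terms
      have hdecomp : C.eval K (pre ++ x :: y :: suf) = C.eval K (pre ++ y :: x :: suf) +
          C.eval K pre * (MonoidAlgebra.of K S ⁅C.gen x, C.gen y⁆ - 1) *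
            ((C.u K y * C.u K x + C.u K y + C.u K x + 1) * C.eval K suf) := by
        have hxy' := C.u_mul_u (K := K) x y
        have e1 : C.eval K (pre ++ x :: y :: suf) = C.eval K pre * (C.u K x * C.u K y) * C.eval K suf := by
          simp only [eval_append, eval_cons]; noncomm_ring
        have e2 : C.eval K (pre ++ y :: x :: suf) = C.eval K pre * (C.u K y * C.u K x) * C.eval K suf := by
          simp only [eval_append, eval_cons]; noncomm_ring
        rw [e1, e2, hxy']
        noncomm_ring
      rw [hdecomp]
      refine Submodule.add_mem _ h1 ?_
      rw [C.commExp_prod, C.of_orderedProd]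
      refine C.mul_mem_of_mem_span (C.prod_add_one_mem_span (canonWord (C.commExp x y))).2 _ _ ?_
      intro c hc
      have hwc : C.W x + C.W y < C.wt c := by
        have h := C.wt_ge_of_sublist_canon (C.commExp_lvl x y) hc.1 hc.2
        have hx : C.W x ≤ (p + 1) ^ max (C.lvl x) (C.lvl y) :=
          Nat.pow_le_pow_right (Nat.succ_pos p) (le_max_left _ _)
        have hy : C.W y ≤ (p + 1) ^ max (C.lvl x) (C.lvl y) :=
          Nat.pow_le_pow_right (Nat.succ_pos p) (le_max_right _ _)
        have h2 : 2 * (p + 1) ^ max (C.lvl x) (C.lvl y) <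
            (p + 1) ^ (max (C.lvl x) (C.lvl y) + 1) := by
          rw [pow_succ]
          have : 0 < (p + 1) ^ max (C.lvl x) (C.lvl y) := Nat.pow_pos (Nat.succ_pos p)
          nlinarith
        omega
      -- four words, each of weight `> wt`
      have e4 : C.eval K pre * C.eval K c *
          ((C.u K y * C.u K x + C.u K y + C.u K x + 1) * C.eval K suf) =
          C.eval K (pre ++ c ++ y :: x :: suf) + C.eval K (pre ++ c ++ y :: suf) +
            C.eval K (pre ++ c ++ x :: suf) + C.eval K (pre ++ c ++ suf) := by
        simp only [eval_append, eval_cons]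
        noncomm_ring
      rw [e4]
      have hk : ∀ v' : List ι, C.wt (pre ++ x :: y :: suf) < C.wt v' →
          C.eval K v' ∈ C.M K (C.wt (pre ++ x :: y :: suf)) := fun v' hv' =>
        C.M_anti hv'.le (hIH v' (hv ▸ hv'))
      refine Submodule.add_mem _ (Submodule.add_mem _ (Submodule.add_mem _ (hk _ ?_) (hk _ ?_))
        (hk _ ?_)) (hk _ ?_) <;>
      · simp only [wt_append, wt_cons]; omega

/-- `M_a · M_b ⊆ M_{a+b}`: the weight filtration is multiplicative (immediate from straightening:
the concatenation of two canonical words has the total weight).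
[cite: BlasiakChurchCohnGrochowUmans2017, Prop. 3.10] -/
theorem M_mul_M_le (a b : ℕ) : C.M K a * C.M K b ≤ C.M K (a + b) := by
  rw [M, M, Submodule.span_mul_span]
  refine Submodule.span_le.2 ?_
  rintro _ ⟨_, ⟨w₁, hw₁, rfl⟩, _, ⟨w₂, hw₂, rfl⟩, rfl⟩
  show C.eval K w₁ * C.eval K w₂ ∈ C.M K (a + b)
  rw [← eval_append]
  refine C.M_anti ?_ (C.eval_mem_M (w₁ ++ w₂))
  rw [wt_append]
  exact Nat.add_le_add hw₁.2 hw₂.2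

/-- All words lie in the span of the canonical words (`M 0`). [folklore] -/
theorem M_zero_eq_top : C.M K 0 = ⊤ := by
  refine eq_top_iff.2 ?_
  rw [← C.span_eval_eq_top (K := K)]
  refine Submodule.span_le.2 ?_
  rintro _ ⟨w, rfl⟩
  exact C.M_anti (Nat.zero_le _) (C.eval_mem_M w)

end Straighten



/-! ## The monomial basis of `K[S]` and its grading -/

section Basis

variable [Fintype S] [Fact p.Prime] [CharP K p]

variable (K) in
/-- The monomial `u^e = ∏ₐ u_a^{e a}` of an exponent vector `e ∈ [0,p)^n` (the Jennings-type
basis vectors of `K[S]`, BCCGU 2017, Prop. 3.10). [cite: BlasiakChurchCohnGrochowUmans2017, Prop. 3.10] -/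
def monomial (e : ι → Fin p) : MonoidAlgebra K S := C.eval K (canonWord fun a => (e a : ℕ))

/-- The weighted degree `Σₐ e(a)·(p+1)^{lvl a}` of a monomial. [cite: BlasiakChurchCohnGrochowUmans2017, Prop. 3.10] -/
def deg (e : ι → Fin p) : ℕ := ∑ a, (e a : ℕ) * C.W a

omit [Fintype S] [Fact p.Prime] [CharP K p] in
/-- The weight of the canonical word of an exponent vector is its degree. [folklore] -/
theorem wt_canon_expo (e : ι → Fin p) : C.wt (canonWord fun a => (e a : ℕ)) = C.deg e :=
  C.wt_canon _

omit [Fintype S] [Fact p.Prime] [CharP K p] in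
/-- The monomials are exactly the evaluations of the canonical words. [folklore] -/
theorem range_monomial : Set.range (C.monomial K) = C.eval K '' {w | IsCanonWord p w} := by
  ext z
  constructor
  · rintro ⟨e, rfl⟩
    exact ⟨_, isCanonWord_canonWord (fun a => (e a).is_lt), rfl⟩
  · rintro ⟨w, ⟨hsort, hcount⟩, rfl⟩
    refine ⟨fun a => ⟨w.count a, hcount a⟩, ?_⟩
    show C.eval K (canonWord fun a => (w.count a : ℕ)) = C.eval K w
    rw [← eq_canonWord_count hsort]

omit [Fintype S] in
/-- The monomials span `K[S]`. [cite: BlasiakChurchCohnGrochowUmans2017, Prop. 3.10] -/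
theorem span_monomial_eq_top : Submodule.span K (Set.range (C.monomial K)) = ⊤ := by
  rw [range_monomial]
  refine eq_top_iff.2 ?_
  rw [← C.M_zero_eq_top (K := K)]
  exact Submodule.span_mono (Set.image_mono fun w hw => hw.1)

omit [Fact p.Prime] [CharP K p] in
include C in
/-- `#[0,p)^n = pⁿ = |S| = dim K[S]`. [cite: BlasiakChurchCohnGrochowUmans2017, Prop. 3.10] -/
theorem card_expo_eq_finrank : Fintype.card (ι → Fin p) = Module.finrank K (MonoidAlgebra K S) := by
  rw [Fintype.card_fun, Fintype.card_fin,
    Module.finrank_eq_card_basis (MonoidAlgebra.basis S K), ← Nat.card_eq_fintype_card (α := S),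
    C.card_eq]

variable (K) in
/-- **The monomial basis** `(u^e)_{e ∈ [0,p)^n}` of `K[S]` (spanning family of the right size).
[cite: BlasiakChurchCohnGrochowUmans2017, Prop. 3.10] -/
def basis : Module.Basis (ι → Fin p) K (MonoidAlgebra K S) :=
  basisOfTopLeSpanOfCardEqFinrank (C.monomial K) (C.span_monomial_eq_top).ge C.card_expo_eq_finrank

/-- The basis vectors are the monomials. [folklore] -/
@[simp] theorem coe_basis : ⇑(C.basis K) = C.monomial K :=
  coe_basisOfTopLeSpanOfCardEqFinrank _ _ _

omit [Fintype S] in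
/-- **Multiplicativity of the grading**: `u^i · u^j ∈ span{u^k : deg i + deg j ≤ deg k}`.
[cite: BlasiakChurchCohnGrochowUmans2017, Prop. 3.10] -/
theorem monomial_mul_mem (i j : ι → Fin p) :
    C.monomial K i * C.monomial K j ∈
      Submodule.span K (C.monomial K '' {k | C.deg i + C.deg j ≤ C.deg k}) := by
  have h : C.monomial K i * C.monomial K j ∈ C.M K (C.deg i + C.deg j) := by
    rw [monomial, monomial, ← eval_append]
    refine C.M_anti ?_ (C.eval_mem_M _)
    rw [wt_append, wt_canon_expo, wt_canon_expo]
  refine Submodule.span_mono ?_ h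
  rintro _ ⟨w, ⟨⟨hsort, hcount⟩, hk⟩, rfl⟩
  refine ⟨fun a => ⟨w.count a, hcount a⟩, ?_, ?_⟩
  · show C.deg i + C.deg j ≤ C.deg fun a => (⟨w.count a, hcount a⟩ : Fin p)
    have : C.deg (fun a => (⟨w.count a, hcount a⟩ : Fin p)) = C.wt w := by
      rw [← wt_canon_expo]
      show C.wt (canonWord fun a => w.count a) = C.wt w
      rw [← eq_canonWord_count hsort]
    rw [this]
    exact hk
  · show C.eval K (canonWord fun a => (w.count a : ℕ)) = C.eval K w
    rw [← eq_canonWord_count hsort]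

variable (K) in
/-- **Graded coordinates on `K[S]` from a `p`-central generating system** (`char K = p`): the
monomial basis with its weighted degree, fed into `GradedCoords.ofBasis`.
[cite: BlasiakChurchCohnGrochowUmans2017, Prop. 3.10 and Prop. 3.2] -/
def gradedCoords [DecidableEq S] : GradedCoords K S (ι → Fin p) :=
  GradedCoords.ofBasis (C.basis K) C.deg (by rw [coe_basis]; exact C.monomial_mul_mem)

/-- The degree of the graded coordinates. [folklore] -/
@[simp] theorem gradedCoords_deg [DecidableEq S] : (C.gradedCoords K).deg = C.deg := rfl

end Basis

end PCGS

end Literature.Barriers.MatrixMultiplication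

end
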